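import Mathlib
import Literature.AlgebraicGeometry.Resolution.BlowupStalkEmbedding
import HarnessLib

/-!
# Branches through the points of a blowing up: the valuative criterion

Topic: `Literature/AlgebraicGeometry/Resolution`. For a proper blowing up `ρ : C' → C` of an
integral locally Noetherian scheme and a point `x ∈ C`, every valuation ring `V` of `K(C)`
dominating `𝒪_{C,x}` **dominates exactly one** local ring `𝒪_{C',x'}` with `ρ x' = x`, through
the canonical embeddings `ε_{x'} : 𝒪_{C',x'} ↪ K(C)` (`BlowupStalkEmbedding.lean`): existence by
the valuative criterion of properness, uniqueness by the valuative criterion of separatedness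
(Mathlib `UniversallyClosed.eq_valuativeCriterion`, `IsSeparated.valuativeCriterion`). This is the
"branch" axiom of `IsFirstNeighbourhood` (`CurveDeltaDrop.lean`) for the points of the blowing up
of a point of a curve (Kollár 2007, §1.4; Cossart–Piltant 2008, proof of Prop. 4.4). PROVED:

* `IsBlowup.valuativeCommSq` — the valuative square `Spec K(C) → C'`, `Spec V → Spec 𝒪_{C,x} → C`;
* `IsBlowup.exists_point_stalkEmb_mem` — **existence** of `x'` over `x` with `ε_{x'}(𝒪_{C',x'}) ⊆ V`
  (and a local `𝒪_{C',x'} → V` inducing it);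
* `IsBlowup.eq_of_stalkEmb_factors` — **uniqueness**: two points over `x` whose local rings map
  locally to `V` compatibly with `ε` coincide.

## Sources

* J. Kollár, *Lectures on Resolution of Singularities* (2007), §1.4. [Kollar2007]
* The Stacks Project, Tag 01KF, Tag 01KZ (valuative criteria). [StacksProject]
-/

noncomputable section

open CategoryTheory AlgebraicGeometry TopologicalSpace IsLocalRing

namespace Literature.AlgebraicGeometry.Resolution

universe u

variable {C' C : Scheme.{u}} {ρ : C' ⟶ C} {J : C.IdealSheafData}
  [IsIntegral C] [IsIntegral C'] [IsLocallyNoetherian C]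

/-! ## The valuative square -/

section Square

variable (hρ : IsBlowup ρ J) (x : C) (V : ValuationSubring C.functionField)
  (hV : ∀ r : C.presheaf.stalk x, algebraMap (C.presheaf.stalk x) C.functionField r ∈ V)

/-- `𝒪_{C,x} → V`. [folklore] -/
def stalkToValuationSubring : C.presheaf.stalk x →+* V :=
  (algebraMap (C.presheaf.stalk x) C.functionField).codRestrict V.toSubring hV

omit [IsIntegral C'] [IsLocallyNoetherian C] in
/-- `(𝒪_{C,x} → V → K(C)) = (𝒪_{C,x} ⊆ K(C))`. [folklore] -/
theorem subtype_comp_toValuationSubring :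
    (V.subtype).comp (stalkToValuationSubring x V hV) =
      algebraMap (C.presheaf.stalk x) C.functionField :=
  RingHom.ext fun _ => rfl

omit [IsIntegral C'] [IsLocallyNoetherian C] in
/-- `V → K(C)` is the algebra map. [folklore] -/
theorem algebraMap_valuationSubring_eq : algebraMap V C.functionField = V.subtype := rfl

/-- **The valuative square** of `ρ` at `x` and `V`: top `Spec K(C) → C'` the canonical
`K(C)`-point (through the generic point), bottom `Spec V → Spec 𝒪_{C,x} → C`.
[cite: StacksProject, Tag 01KF] -/
def IsBlowup.valuativeCommSq : ValuativeCommSq ρ where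
  R := V
  K := C.functionField
  i₁ := Spec.map (CommRingCat.ofHom (hρ.stalkEmb (genericPoint C'))) ≫
    C'.fromSpecStalk (genericPoint C')
  i₂ := Spec.map (CommRingCat.ofHom (stalkToValuationSubring x V hV)) ≫ C.fromSpecStalk x
  commSq := ⟨by
    rw [Category.assoc, hρ.SpecMap_stalkEmb_fromSpecStalk_comp, ← Category.assoc, ← Spec.map_comp,
      ← CommRingCat.ofHom_comp, algebraMap_valuationSubring_eq, subtype_comp_toValuationSubring,
      SpecMap_algebraMap_fromSpecStalk]⟩

end Square

/-! ## Existence of a point dominated by a valuation ring -/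

section Existence

variable (hρ : IsBlowup ρ J) [IsProper ρ] (x : C) (V : ValuationSubring C.functionField)
  (hV : ∀ r : C.presheaf.stalk x, algebraMap (C.presheaf.stalk x) C.functionField r ∈ V)
  (hloc : IsLocalHom (stalkToValuationSubring x V hV))

include hloc in
/-- **Existence (valuative criterion of properness)**: there is a point `x'` of `C'` over `x`
and a local homomorphism `g : 𝒪_{C',x'} → V` with `(V ⊆ K(C)) ∘ g = ε_{x'}`; in particular
`ε_{x'}(𝒪_{C',x'}) ⊆ V`. [cite: Kollar2007, §1.4] [cite: StacksProject, Tag 01KF] -/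
theorem IsBlowup.exists_point_stalkEmb_mem :
    ∃ x' : C', ρ x' = x ∧ ∃ g : C'.presheaf.stalk x' →+* V, IsLocalHom g ∧
      (V.subtype).comp g = hρ.stalkEmb x' := by
  haveI := hloc
  -- the lift
  have hE : ValuativeCriterion.Existence ρ := by
    have h : (ValuativeCriterion.Existence ⊓ @QuasiCompact) ρ :=
      UniversallyClosed.eq_valuativeCriterion ▸ (inferInstance : UniversallyClosed ρ)
    exact h.1
  let S := hρ.valuativeCommSq x V hV
  haveI : S.commSq.HasLift := hE S
  let l : Spec (.of V) ⟶ C' := S.commSq.lift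
  have hl₁ : Spec.map (CommRingCat.ofHom (algebraMap V C.functionField)) ≫ l = S.i₁ :=
    S.commSq.fac_left
  have hl₂ : l ≫ ρ = S.i₂ := S.commSq.fac_right
  -- compare `l ≫ ρ` and `i₂` through `SpecToEquivOfLocalRing`
  haveI : IsLocalHom (CommRingCat.ofHom (stalkToValuationSubring x V hV)).hom := hloc
  have hi₂ : S.i₂ = (SpecToEquivOfLocalRing C (.of V)).symm
      ⟨x, CommRingCat.ofHom (stalkToValuationSubring x V hV), inferInstance⟩ := rfl
  have hkey := congrArg (SpecToEquivOfLocalRing C (.of V)) (hl₂.trans hi₂)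
  rw [Equiv.apply_symm_apply] at hkey
  obtain ⟨h₁, h₂⟩ := SpecToEquivOfLocalRing_eq_iff.mp hkey
  -- `h₁ : (l ≫ ρ) (closedPoint V) = x`, `h₂ : stalkClosedPointTo (l ≫ ρ) = stalkCongr ≫ gV`
  change (l ≫ ρ) (closedPoint V) = x at h₁
  change Scheme.stalkClosedPointTo (l ≫ ρ) = _ at h₂
  rw [Scheme.stalkClosedPointTo_comp] at h₂
  refine ⟨l (closedPoint V), h₁, (Scheme.stalkClosedPointTo l).hom, inferInstance, ?_⟩
  -- uniqueness of `ε_{x'}`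
  refine hρ.stalkEmb_unique _ _ (RingHom.ext fun a => ?_)
  have h₂a := congrArg (fun f => (CommRingCat.Hom.hom f) a) h₂
  simp only [CommRingCat.hom_comp, RingHom.comp_apply] at h₂a
  change V.subtype ((Scheme.stalkClosedPointTo l).hom ((ρ.stalkMap _).hom a)) = _
  rw [h₂a]
  change ((algebraMap (C.presheaf.stalk x) C.functionField).comp
    (C.presheaf.stalkCongr (.of_eq h₁)).hom.hom) a = _
  rw [TopCat.Presheaf.stalkCongr_hom, algebraMap_comp_stalkSpecializes]
  rfl

end Existence

/-! ## Uniqueness of the dominated point -/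

section Uniqueness

variable (hρ : IsBlowup ρ J) [IsSeparated ρ] (x : C) (V : ValuationSubring C.functionField)
  (hV : ∀ r : C.presheaf.stalk x, algebraMap (C.presheaf.stalk x) C.functionField r ∈ V)
  (hloc : IsLocalHom (stalkToValuationSubring x V hV))

omit [IsSeparated ρ] in
include hloc in
/-- A local homomorphism `g : 𝒪_{C',x'} → V` inducing `ε_{x'}` gives a lift `Spec V → C'` of
the valuative square through `x'`. [cite: StacksProject, Tag 01KZ] -/
theorem IsBlowup.liftStruct_of_stalkEmb_factors {x' : C'} (hx' : ρ x' = x)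
    (g : C'.presheaf.stalk x' →+* V) [IsLocalHom g] (hg : (V.subtype).comp g = hρ.stalkEmb x') :
    ∃ L : (hρ.valuativeCommSq x V hV).commSq.LiftStruct,
      L.l = Spec.map (CommRingCat.ofHom g) ≫ C'.fromSpecStalk x' := by
  refine ⟨⟨Spec.map (CommRingCat.ofHom g) ≫ C'.fromSpecStalk x', ?_, ?_⟩, rfl⟩
  · -- upper triangle: the `K(C)`-points coincide
    change Spec.map (CommRingCat.ofHom (algebraMap V C.functionField)) ≫
      Spec.map (CommRingCat.ofHom g) ≫ C'.fromSpecStalk x' =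
        Spec.map (CommRingCat.ofHom (hρ.stalkEmb (genericPoint C'))) ≫
          C'.fromSpecStalk (genericPoint C')
    rw [← Category.assoc, ← Spec.map_comp, ← CommRingCat.ofHom_comp, algebraMap_valuationSubring_eq,
      hg, hρ.SpecMap_stalkEmb_fromSpecStalk]
  · -- lower triangle: compare through `SpecToEquivOfLocalRing`
    change (Spec.map (CommRingCat.ofHom g) ≫ C'.fromSpecStalk x') ≫ ρ =
      Spec.map (CommRingCat.ofHom (stalkToValuationSubring x V hV)) ≫ C.fromSpecStalk x
    haveI : IsLocalHom (CommRingCat.ofHom g).hom := ‹IsLocalHom g›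
    haveI hgl : IsLocalHom (ρ.stalkMap x' ≫ CommRingCat.ofHom g).hom := by
      rw [CommRingCat.hom_comp]
      exact RingHom.isLocalHom_comp _ _
    have e1 : (Spec.map (CommRingCat.ofHom g) ≫ C'.fromSpecStalk x') ≫ ρ =
        (SpecToEquivOfLocalRing C (.of V)).symm
          ⟨ρ x', ρ.stalkMap x' ≫ CommRingCat.ofHom g, hgl⟩ := by
      rw [Category.assoc, ← Scheme.SpecMap_stalkMap_fromSpecStalk, ← Category.assoc,
        ← Spec.map_comp]
      rfl
    haveI : IsLocalHom (CommRingCat.ofHom (stalkToValuationSubring x V hV)).hom := hloc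
    have e2 : Spec.map (CommRingCat.ofHom (stalkToValuationSubring x V hV)) ≫ C.fromSpecStalk x =
        (SpecToEquivOfLocalRing C (.of V)).symm
          ⟨x, CommRingCat.ofHom (stalkToValuationSubring x V hV), inferInstance⟩ := rfl
    rw [e1, e2]
    congr 1
    refine SpecToEquivOfLocalRing_eq_iff.mpr ⟨hx', ?_⟩
    -- equality of ring maps `𝒪_{C,ρ x'} → V`, checked in `K(C)`
    ext a
    change ((V.subtype).comp g) ((ρ.stalkMap x').hom a) =
      ((algebraMap (C.presheaf.stalk x) C.functionField).comp
        (C.presheaf.stalkCongr (.of_eq hx')).hom.hom) a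
    rw [hg, hρ.stalkEmb_stalkMap, TopCat.Presheaf.stalkCongr_hom, algebraMap_comp_stalkSpecializes]

include hloc in
/-- **Uniqueness (valuative criterion of separatedness)**: two points over `x` whose local rings
map locally to `V` compatibly with the canonical embeddings coincide.
[cite: Kollar2007, §1.4] [cite: StacksProject, Tag 01KZ] -/
theorem IsBlowup.eq_of_stalkEmb_factors {x' x'' : C'} (hx' : ρ x' = x) (hx'' : ρ x'' = x)
    (g' : C'.presheaf.stalk x' →+* V) [IsLocalHom g'] (hg' : (V.subtype).comp g' = hρ.stalkEmb x')
    (g'' : C'.presheaf.stalk x'' →+* V) [IsLocalHom g'']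
    (hg'' : (V.subtype).comp g'' = hρ.stalkEmb x'') : x' = x'' := by
  obtain ⟨L', hL'⟩ := hρ.liftStruct_of_stalkEmb_factors x V hV hloc hx' g' hg'
  obtain ⟨L'', hL''⟩ := hρ.liftStruct_of_stalkEmb_factors x V hV hloc hx'' g'' hg''
  haveI := IsSeparated.valuativeCriterion ρ (hρ.valuativeCommSq x V hV)
  have hLL : L' = L'' := Subsingleton.elim _ _
  have hl : L'.l = L''.l := by rw [hLL]
  rw [hL', hL''] at hl
  have h : (Spec.map (CommRingCat.ofHom g') ≫ C'.fromSpecStalk x') (closedPoint V) =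
      (Spec.map (CommRingCat.ofHom g'') ≫ C'.fromSpecStalk x'') (closedPoint V) :=
    congrArg (fun l : Spec (.of V) ⟶ C' => l (closedPoint V)) hl
  haveI : IsLocalHom (CommRingCat.ofHom g').hom := ‹IsLocalHom g'›
  haveI : IsLocalHom (CommRingCat.ofHom g'').hom := ‹IsLocalHom g''›
  rw [Scheme.Hom.comp_apply, Scheme.Hom.comp_apply, Spec_closedPoint, Spec_closedPoint,
    Scheme.fromSpecStalk_closedPoint, Scheme.fromSpecStalk_closedPoint] at h
  exact h

end Uniqueness

end Literature.AlgebraicGeometry.Resolution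

end
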